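import Summits.SmoothPoincare4.SmoothPoincare4.Theorems.ConvexBisectionAcyclicBisectionExistsChartedChainBranch
import Mathlib.Analysis.SpecialFunctions.Complex.LogDeriv
import Mathlib.Analysis.Complex.CauchyIntegral
import HarnessLib

/-!
# The Joukowski branch, II: the page scaling `(x, y) ↦ (λ x, μ y)`, bounds and smoothness
(wave 4, brick Y4-2b of the model chain (R2) `exists_charted_chain` for the missing lemma
`crossingNumber_eq_stdSymp` of node N1a of stub `stub_modelsOnFibred_of_reach` = NF4, line
`modp-braid-orbits`, crux `ConvexBisection.AcyclicBisectionExists`, item stmt-SmoothPoincare4-10508;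
registered sub-goal `helper_pagePt_mem_page`)

Sequel of `…ChartedChainBranch.lean` (`jX`, `jY`, `bS`, `jY² = jX^{2g+1} + 1`).

* §1 **the page scaling.**  For a direction `c` (`‖c‖ ≤ 1`) put `λ = (1 + c/2)^{1/(2g+1)}`
  (`scaleX`), `μ = √(1 + c/2)` (`scaleY`) and `pagePt g c x y = (λ x, μ y) ∈ ℂ² = ℝ⁴`: a point of
  the central page `y² = x^{2g+1} + 1` with `‖x‖² < 16/9` goes to the page
  `w = y² − x^{2g+1} − 1 = c/2` of the base, over `‖x‖ < 2` (`w_pagePt`, `rho_pagePt_le`,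
  **`helper_pagePt_mem_page`**); `pagePt g c` is injective, and continuous in `c` along `s c`,
  `s ∈ [−1, 1]`.
* §2 **bounds on the Joukowski coordinate** for `1 ≤ ‖t‖ ≤ 1 + δ`: `Re jX t = m − σ Im J(t)`,
  `|Im J| ≤ ‖t‖ − 1`, `‖jX t‖² ≤ 1 + 5δ`, and the STRIP CONDITION `cos θ_1 < Re (jX t)` for
  `‖t‖ < 1 + 2σ` (in particular for `‖t‖ ≤ 1 + 1/(2g+1)`; `m − cos θ_1 = 4mσ² ≥ 2σ²`,
  `σ ≥ 2/(2g+1)`), under which `bS` is holomorphic at `jX t`.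
* §3 **smoothness**: `jX` has complex derivative `σ i (1 − t⁻²)/2 ≠ 0` off the unit circle, `jY` is
  holomorphic on the open set `{t ≠ 0, cos θ_1 < Re jX t}`, hence both are real `C^∞` there.

Everything is proved; no `sorry`.  References: J. Milnor, *Singular points of complex
hypersurfaces* (1968), §9 [Milnor1968].
-/

noncomputable section

set_option linter.dupNamespace false

open scoped Manifold ContDiff Topology ComplexConjugate Real
open Set Function Metric Complex
open Literature.Topology.FourManifolds Literature.Topology.FourManifolds.LefschetzBase

namespace Summit.SmoothPoincare4.SmoothPoincare4.Theorems.AcyclicBisectionExists.ModpBraidOrbits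

variable {g : ℕ} {c : ℂ}

/-! ## §1 The page scaling -/

/-- `λ = (1 + c/2)^{1/(2g+1)}` (principal root). [folklore] -/
def scaleX (g : ℕ) (c : ℂ) : ℂ := (1 + c / 2) ^ ((2 * g + 1 : ℕ) : ℂ)⁻¹

/-- `μ = √(1 + c/2)` (principal root). [folklore] -/
def scaleY (c : ℂ) : ℂ := csqrt (1 + c / 2)

/-- `λ^{2g+1} = 1 + c/2`. [folklore] -/
theorem scaleX_pow (g : ℕ) (c : ℂ) : scaleX g c ^ (2 * g + 1) = 1 + c / 2 :=
  Complex.cpow_nat_inv_pow _ (Nat.succ_ne_zero _)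

/-- `μ² = 1 + c/2`. [folklore] -/
theorem scaleY_sq (c : ℂ) : scaleY c ^ 2 = 1 + c / 2 := csqrt_sq _

/-- `Re (1 + c/2) ≥ 1/2 > 0` for `‖c‖ ≤ 1`. [folklore] -/
theorem re_one_add_half_pos (hc : ‖c‖ ≤ 1) : 0 < (1 + c / 2).re := by
  have h : |c.re| ≤ 1 := (Complex.abs_re_le_norm c).trans hc
  have h' := neg_abs_le c.re
  simp; linarith

/-- `1 + c/2 ≠ 0` for `‖c‖ ≤ 1`. [folklore] -/
theorem one_add_half_ne_zero (hc : ‖c‖ ≤ 1) : 1 + c / 2 ≠ 0 := fun h => by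
  have := re_one_add_half_pos hc; rw [h] at this; simp at this

/-- `λ ≠ 0`. [folklore] -/
theorem scaleX_ne_zero (hc : ‖c‖ ≤ 1) : scaleX g c ≠ 0 := by
  rw [scaleX, Ne, Complex.cpow_eq_zero_iff, not_and_or]
  exact Or.inl (one_add_half_ne_zero hc)

/-- `μ ≠ 0`. [folklore] -/
theorem scaleY_ne_zero (hc : ‖c‖ ≤ 1) : scaleY c ≠ 0 := csqrt_ne_zero (one_add_half_ne_zero hc)

/-- `‖λ‖ ≤ 3/2` (`‖1 + c/2‖ ≤ 3/2` and `r^{1/n} ≤ max 1 r`). [folklore] -/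
theorem norm_scaleX_le (hc : ‖c‖ ≤ 1) : ‖scaleX g c‖ ≤ 3 / 2 := by
  have hz : ‖1 + c / 2‖ ≤ 3 / 2 := by
    calc ‖1 + c / 2‖ ≤ ‖(1 : ℂ)‖ + ‖c / 2‖ := norm_add_le _ _
      _ ≤ 3 / 2 := by rw [norm_one, norm_div, Complex.norm_two]; linarith
  have hy : ((2 * g + 1 : ℕ) : ℂ)⁻¹ = (((2 * g + 1 : ℕ) : ℝ)⁻¹ : ℝ) := by push_cast; rfl
  have hy0 : (0 : ℝ) ≤ ((2 * g + 1 : ℕ) : ℝ)⁻¹ := by positivity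
  have hy1 : ((2 * g + 1 : ℕ) : ℝ)⁻¹ ≤ 1 := inv_le_one_of_one_le₀ (by exact_mod_cast Nat.succ_pos _)
  rw [scaleX, hy, Complex.norm_cpow_real]
  rcases le_total ‖1 + c / 2‖ 1 with h1 | h1
  · exact (Real.rpow_le_one (norm_nonneg _) h1 hy0).trans (by norm_num)
  · calc ‖1 + c / 2‖ ^ ((2 * g + 1 : ℕ) : ℝ)⁻¹ ≤ ‖1 + c / 2‖ ^ (1 : ℝ) :=
          Real.rpow_le_rpow_of_exponent_le h1 hy1
      _ ≤ 3 / 2 := by rwa [Real.rpow_one]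

/-- **The scaled page point** `pagePt g c x y = (λ x, μ y)`. [folklore] -/
def pagePt (g : ℕ) (c x y : ℂ) : EuclideanSpace ℝ (Fin 4) := mk (scaleX g c * x) (scaleY c * y)

/-- `x`-coordinate. [folklore] -/
@[simp] theorem cx_pagePt (g : ℕ) (c x y : ℂ) : cx (pagePt g c x y) = scaleX g c * x := cx_mk _ _

/-- `y`-coordinate. [folklore] -/
@[simp] theorem cy_pagePt (g : ℕ) (c x y : ℂ) : cy (pagePt g c x y) = scaleY c * y := cy_mk _ _

/-- **On the central page the scaled point has `w = c/2`.** [folklore] -/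
theorem w_pagePt {x y : ℂ} (hy : y ^ 2 = x ^ (2 * g + 1) + 1) : w g (pagePt g c x y) = c / 2 := by
  rw [w_eq', cx_pagePt, cy_pagePt, mul_pow, mul_pow, scaleX_pow, scaleY_sq, hy]; ring

/-- `‖λ x‖² < 4` when `‖x‖² < 16/9`. [folklore] -/
theorem norm_cx_pagePt_sq_lt (hc : ‖c‖ ≤ 1) {x : ℂ} (y : ℂ) (hx : ‖x‖ ^ 2 < 16 / 9) :
    ‖cx (pagePt g c x y)‖ ^ 2 < 4 := by
  rw [cx_pagePt, norm_mul, mul_pow]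
  have h1 : ‖scaleX g c‖ ^ 2 ≤ 9 / 4 := by nlinarith [norm_scaleX_le (g := g) hc, norm_nonneg (scaleX g c)]
  nlinarith [norm_nonneg x, sq_nonneg ‖scaleX g c‖]

/-- **The scaled point lies in the base** (`rho = ‖c‖²/4 ≤ 1/4`, `eta = 0`). [folklore] -/
theorem rho_pagePt_le (hc : ‖c‖ ≤ 1) {x y : ℂ} (hy : y ^ 2 = x ^ (2 * g + 1) + 1)
    (hx : ‖x‖ ^ 2 < 16 / 9) : rho g (pagePt g c x y) ≤ 1 / 4 := by
  rw [rho, w_pagePt hy, eta_of_le (norm_cx_pagePt_sq_lt hc y hx).le, norm_div, Complex.norm_two]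
  nlinarith [norm_nonneg c]

/-- The scaled point as a point of the base. [folklore] -/
def basePt (hc : ‖c‖ ≤ 1) {x y : ℂ} (hy : y ^ 2 = x ^ (2 * g + 1) + 1) (hx : ‖x‖ ^ 2 < 16 / 9) :
    Base g :=
  ⟨pagePt g c x y, rho_pagePt_le hc hy hx⟩

/-- **Sub-goal `helper_pagePt_mem_page`** (Y4-2b of the model chain (R2) for node N1a of NF4): the
scaled point of a point of the central page over `‖x‖² < 16/9` lies in the page of direction `c`.
[cite: Milnor1968, §9] -/
theorem helper_pagePt_mem_page : ∀ (g : ℕ) (c : ℂ) (hc : ‖c‖ ≤ 1) (x y : ℂ) (hy : y ^ 2 = x ^ (2 * g + 1) + 1) (hx : ‖x‖ ^ 2 < 16 / 9), (⟨Summit.SmoothPoincare4.SmoothPoincare4.Theorems.AcyclicBisectionExists.ModpBraidOrbits.pagePt g c x y, Summit.SmoothPoincare4.SmoothPoincare4.Theorems.AcyclicBisectionExists.ModpBraidOrbits.rho_pagePt_le hc hy hx⟩ : Literature.Topology.FourManifolds.LefschetzBase.Base g) ∈ Literature.Topology.FourManifolds.LefschetzBase.page g c :=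
  fun _ _ hc _ y hy hx => ⟨norm_cx_pagePt_sq_lt hc y hx, w_pagePt hy⟩

/-- The scaled point lies in the page of direction `c`. [folklore] -/
theorem basePt_mem_page (hc : ‖c‖ ≤ 1) {x y : ℂ} (hy : y ^ 2 = x ^ (2 * g + 1) + 1)
    (hx : ‖x‖ ^ 2 < 16 / 9) : basePt hc hy hx ∈ page g c :=
  helper_pagePt_mem_page g c hc _ _ hy hx

/-- **The scaling is injective.** [folklore] -/
theorem pagePt_inj (hc : ‖c‖ ≤ 1) {x y x' y' : ℂ} :
    pagePt g c x y = pagePt g c x' y' ↔ x = x' ∧ y = y' := by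
  constructor
  · intro h
    have hx := congrArg cx h
    have hy := congrArg cy h
    rw [cx_pagePt, cx_pagePt] at hx
    rw [cy_pagePt, cy_pagePt] at hy
    exact ⟨mul_left_cancel₀ (scaleX_ne_zero hc) hx, mul_left_cancel₀ (scaleY_ne_zero hc) hy⟩
  · rintro ⟨rfl, rfl⟩; rfl

/-- `1 + s c/2` is in the slit plane for `|s| ≤ 1`, `‖c‖ ≤ 1`. [folklore] -/
theorem one_add_smul_half_mem_slitPlane (hc : ‖c‖ ≤ 1) {s : ℝ} (hs : |s| ≤ 1) :
    1 + (s : ℂ) * c / 2 ∈ slitPlane := by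
  rw [Complex.mem_slitPlane_iff]; left
  have h : ‖(s : ℂ) * c‖ ≤ 1 := by
    rw [norm_mul, Complex.norm_real, Real.norm_eq_abs]
    nlinarith [norm_nonneg c, abs_nonneg s]
  have := re_one_add_half_pos h
  rwa [mul_div_assoc] at this ⊢

/-- **Continuity of `λ` along `s ↦ s c`** (`|s| ≤ 1`). [folklore] -/
theorem continuousAt_scaleX_smul (hc : ‖c‖ ≤ 1) {s : ℝ} (hs : |s| ≤ 1) :
    ContinuousAt (fun s' : ℝ => scaleX g ((s' : ℂ) * c)) s := by
  unfold scaleX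
  have h1 : ContinuousAt (fun s' : ℝ => 1 + (s' : ℂ) * c / 2) s := by fun_prop
  have h2 : ContinuousAt (fun z : ℂ => z ^ (((2 * g + 1 : ℕ) : ℂ)⁻¹)) (1 + (s : ℂ) * c / 2) :=
    continuousAt_cpow_const (one_add_smul_half_mem_slitPlane hc hs)
  exact ContinuousAt.comp (f := fun s' : ℝ => 1 + (s' : ℂ) * c / 2) h2 h1

/-- **Continuity of `μ` along `s ↦ s c`** (`|s| ≤ 1`). [folklore] -/
theorem continuousAt_scaleY_smul (hc : ‖c‖ ≤ 1) {s : ℝ} (hs : |s| ≤ 1) :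
    ContinuousAt (fun s' : ℝ => scaleY ((s' : ℂ) * c)) s := by
  unfold scaleY csqrt
  have h1 : ContinuousAt (fun s' : ℝ => 1 + (s' : ℂ) * c / 2) s := by fun_prop
  have h2 : ContinuousAt (fun z : ℂ => z ^ ((2 : ℂ)⁻¹)) (1 + (s : ℂ) * c / 2) :=
    continuousAt_cpow_const (one_add_smul_half_mem_slitPlane hc hs)
  exact ContinuousAt.comp (f := fun s' : ℝ => 1 + (s' : ℂ) * c / 2) h2 h1

/-- At `s = 0` the scaling is trivial: `λ = 1`. [folklore] -/
@[simp] theorem scaleX_zero (g : ℕ) : scaleX g 0 = 1 := by simp [scaleX]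

/-- At `s = 0` the scaling is trivial: `μ = 1`. [folklore] -/
@[simp] theorem scaleY_zero : scaleY 0 = 1 := by simp [scaleY]

/-! ## §2 Bounds on the Joukowski coordinate -/

/-- `Re jX t = m − σ · Im J(t)` with `Im J(t) = Im t · (1 − ‖t‖⁻²)/2`. [folklore] -/
theorem jX_re (g : ℕ) (t : ℂ) : (jX g t).re = cmid g - shalf g * (t.im * (1 - (‖t‖ ^ 2)⁻¹) / 2) := by
  simp only [jX, Complex.add_re, Complex.mul_re, Complex.mul_im, Complex.ofReal_re,
    Complex.ofReal_im, Complex.I_re, Complex.I_im, Complex.div_ofNat_re, Complex.div_ofNat_im,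
    Complex.add_im, Complex.inv_im, Complex.normSq_eq_norm_sq]
  ring

/-- `Im jX t = σ · Re J(t)` with `Re J(t) = Re t · (1 + ‖t‖⁻²)/2`. [folklore] -/
theorem jX_im (g : ℕ) (t : ℂ) : (jX g t).im = shalf g * (t.re * (1 + (‖t‖ ^ 2)⁻¹) / 2) := by
  simp only [jX, Complex.add_im, Complex.mul_re, Complex.mul_im, Complex.ofReal_re,
    Complex.ofReal_im, Complex.I_re, Complex.I_im, Complex.div_ofNat_re, Complex.div_ofNat_im,
    Complex.add_re, Complex.inv_re, Complex.normSq_eq_norm_sq]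
  ring

/-- `|Im J(t)| ≤ ‖t‖ − 1` for `‖t‖ ≥ 1`. [folklore] -/
theorem abs_imJ_le {t : ℂ} (ht : 1 ≤ ‖t‖) : |t.im * (1 - (‖t‖ ^ 2)⁻¹) / 2| ≤ ‖t‖ - 1 := by
  have h0 : 0 < ‖t‖ := by linarith
  have h1 : 0 ≤ 1 - (‖t‖ ^ 2)⁻¹ := by
    rw [sub_nonneg]; exact inv_le_one_of_one_le₀ (by nlinarith)
  have h2 : |t.im| ≤ ‖t‖ := Complex.abs_im_le_norm t
  rw [abs_div, abs_mul, abs_of_nonneg h1, abs_two]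
  have h3 : |t.im| * (1 - (‖t‖ ^ 2)⁻¹) ≤ ‖t‖ * (1 - (‖t‖ ^ 2)⁻¹) := mul_le_mul_of_nonneg_right h2 h1
  have h4 : ‖t‖ * (1 - (‖t‖ ^ 2)⁻¹) = ‖t‖ - ‖t‖⁻¹ := by field_simp
  have h5 : ‖t‖ - ‖t‖⁻¹ ≤ 2 * (‖t‖ - 1) := by
    have key : (‖t‖ - ‖t‖⁻¹) - 2 * (‖t‖ - 1) = -((‖t‖ - 1) ^ 2) / ‖t‖ := by field_simp; ring
    have : -((‖t‖ - 1) ^ 2) / ‖t‖ ≤ 0 := div_nonpos_of_nonpos_of_nonneg (neg_nonpos.2 (sq_nonneg _)) h0.le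
    linarith
  linarith

/-- **`Re jX t ≥ m − σ (‖t‖ − 1)`** for `‖t‖ ≥ 1`. [folklore] -/
theorem jX_re_ge (g : ℕ) (hg : 1 ≤ g) {t : ℂ} (ht : 1 ≤ ‖t‖) :
    cmid g - shalf g * (‖t‖ - 1) ≤ (jX g t).re := by
  rw [jX_re]
  have h := (abs_le.1 (abs_imJ_le ht)).2
  nlinarith [shalf_pos hg]

/-- **`‖jX t‖² ≤ 1 + 5δ`** for `1 ≤ ‖t‖ ≤ 1 + δ`, `δ ≤ 1`
(`‖jX‖² = m² + σ²‖J‖² − 2mσ Im J`, `‖J‖ ≤ ‖t‖`, `|Im J| ≤ ‖t‖ − 1`). [folklore] -/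
theorem norm_jX_sq_le (g : ℕ) {t : ℂ} {δ : ℝ} (ht : 1 ≤ ‖t‖) (htδ : ‖t‖ ≤ 1 + δ) (hδ : δ ≤ 1) :
    ‖jX g t‖ ^ 2 ≤ 1 + 5 * δ := by
  have h0 : 0 < ‖t‖ := by linarith
  set J : ℂ := (t + t⁻¹) / 2 with hJ
  have hJn : ‖J‖ ≤ ‖t‖ := by
    rw [hJ, norm_div, Complex.norm_two]
    have := norm_add_le t t⁻¹
    rw [norm_inv] at this
    have : ‖t‖⁻¹ ≤ ‖t‖ := by
      calc ‖t‖⁻¹ ≤ 1 := inv_le_one_of_one_le₀ ht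
        _ ≤ ‖t‖ := ht
    linarith
  have hJi : |J.im| ≤ ‖t‖ - 1 := by
    have e : J.im = t.im * (1 - (‖t‖ ^ 2)⁻¹) / 2 := by
      rw [hJ]
      simp only [Complex.div_ofNat_im, Complex.add_im, Complex.inv_im, Complex.normSq_eq_norm_sq]
      ring
    rw [e]; exact abs_imJ_le ht
  have hx : jX g t = (cmid g : ℂ) + (shalf g : ℂ) * I * J := rfl
  have hnorm : ‖jX g t‖ ^ 2 = cmid g ^ 2 + shalf g ^ 2 * ‖J‖ ^ 2 - 2 * cmid g * shalf g * J.im := by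
    rw [hx, Complex.sq_norm, Complex.sq_norm, Complex.normSq_apply, Complex.normSq_apply]
    simp [Complex.mul_re, Complex.mul_im]; ring
  rw [hnorm]
  have hm : |cmid g| ≤ 1 := Real.abs_cos_le_one _
  have hs : |shalf g| ≤ 1 := Real.abs_sin_le_one _
  have hs0 : 0 ≤ shalf g ^ 2 := sq_nonneg _
  have h1 : shalf g ^ 2 * ‖J‖ ^ 2 ≤ shalf g ^ 2 * (1 + δ) ^ 2 :=
    mul_le_mul_of_nonneg_left (by nlinarith [norm_nonneg J]) hs0
  have h2 : -(2 * cmid g * shalf g * J.im) ≤ 2 * (‖t‖ - 1) := by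
    have : |2 * cmid g * shalf g * J.im| ≤ 2 * 1 * 1 * (‖t‖ - 1) := by
      rw [abs_mul, abs_mul, abs_mul, abs_two]
      gcongr
    linarith [neg_abs_le (2 * cmid g * shalf g * J.im)]
  nlinarith [cmid_sq_add_shalf_sq g, sq_nonneg δ]

/-- `σ ≥ 2/(2g+1)` (`sin x ≥ 2x/π` on `[0, π/2]`, `x = π/(2g+1) ≤ π/3`). [folklore] -/
theorem two_div_le_shalf (hg : 1 ≤ g) : 2 / (2 * g + 1) ≤ shalf g := by
  have h0 : (0 : ℝ) < 2 * g + 1 := by positivity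
  have hg' : (1 : ℝ) ≤ g := by exact_mod_cast hg
  have h := Real.mul_le_sin (x := π / (2 * g + 1)) (by positivity)
    (by rw [div_le_div_iff₀ h0 two_pos]; nlinarith [Real.pi_pos])
  have e : 2 / π * (π / (2 * g + 1)) = 2 / (2 * g + 1) := by field_simp
  rw [e] at h
  unfold shalf branchAngle
  simpa using h

/-- `m ≥ 1/2` (`π/(2g+1) ≤ π/3`). [folklore] -/
theorem half_le_cmid (hg : 1 ≤ g) : 1 / 2 ≤ cmid g := by
  have h0 : (0 : ℝ) < 2 * g + 1 := by positivity
  have hg' : (1 : ℝ) ≤ g := by exact_mod_cast hg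
  rw [cmid, ← Real.cos_pi_div_three]
  refine Real.cos_le_cos_of_nonneg_of_le_pi (by unfold branchAngle; positivity)
    (by linarith [Real.pi_pos]) ?_
  unfold branchAngle
  rw [div_le_div_iff₀ h0 three_pos]
  push_cast
  nlinarith [Real.pi_pos]

/-- **`cos θ_1 = cos 3θ_0 ≤ m − 2σ²`** (`cos 3x = 4cos³x − 3cos x`, so `m − cos θ_1 = 4mσ²`).
[folklore] -/
theorem cos_branchAngle_one_le (hg : 1 ≤ g) : Real.cos (branchAngle g 1) ≤ cmid g - 2 * shalf g ^ 2 := by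
  have e : branchAngle g 1 = 3 * branchAngle g 0 := by unfold branchAngle; push_cast; ring
  rw [e, Real.cos_three_mul]
  have h1 := cmid_sq_add_shalf_sq g
  have hm := half_le_cmid hg
  rw [cmid] at hm
  rw [cmid, shalf] at h1 ⊢
  have key : 4 * Real.cos (branchAngle g 0) ^ 3 - 3 * Real.cos (branchAngle g 0) -
      (Real.cos (branchAngle g 0) - 2 * Real.sin (branchAngle g 0) ^ 2) =
      2 * Real.sin (branchAngle g 0) ^ 2 * (1 - 2 * Real.cos (branchAngle g 0)) +
        4 * Real.cos (branchAngle g 0) * (Real.cos (branchAngle g 0) ^ 2 + Real.sin (branchAngle g 0) ^ 2 - 1) := by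
    ring
  rw [h1, sub_self, mul_zero, add_zero] at key
  nlinarith [key, mul_nonneg (sq_nonneg (Real.sin (branchAngle g 0))) (by linarith : (0 : ℝ) ≤ 2 * Real.cos (branchAngle g 0) - 1)]

/-- **The strip condition**: `cos θ_1 < Re jX t` for `1 ≤ ‖t‖ < 1 + 2σ`. [folklore] -/
theorem strip_of_norm_lt (hg : 1 ≤ g) {t : ℂ} (ht : 1 ≤ ‖t‖) (ht2 : ‖t‖ < 1 + 2 * shalf g) :
    Real.cos (branchAngle g 1) < (jX g t).re := by
  have h1 := jX_re_ge g hg ht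
  have h2 := cos_branchAngle_one_le hg
  have h3 : shalf g * (‖t‖ - 1) < 2 * shalf g ^ 2 := by nlinarith [shalf_pos hg]
  linarith

/-- The strip condition on the annulus `1 ≤ ‖t‖ ≤ 1 + 1/(2g+1)` (`1/(2g+1) < 2σ`). [folklore] -/
theorem strip_of_norm_le (hg : 1 ≤ g) {t : ℂ} (ht : 1 ≤ ‖t‖) (ht2 : ‖t‖ ≤ 1 + 1 / (2 * g + 1)) :
    Real.cos (branchAngle g 1) < (jX g t).re := by
  refine strip_of_norm_lt hg ht (lt_of_le_of_lt ht2 ?_)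
  have := two_div_le_shalf hg
  have h0 : (0 : ℝ) < 2 * g + 1 := by positivity
  have : 1 / (2 * (g : ℝ) + 1) < 2 * (2 / (2 * g + 1)) := by
    rw [div_lt_iff₀ h0]; field_simp; norm_num
  linarith

/-! ## §3 Smoothness of `jX` and `jY` -/

/-- **The complex derivative of `jX`**: `σ i (1 − t⁻²)/2` (`t ≠ 0`). [folklore] -/
theorem hasDerivAt_jX (g : ℕ) {t : ℂ} (ht : t ≠ 0) :
    HasDerivAt (jX g) ((shalf g : ℂ) * I * ((1 - (t ^ 2)⁻¹) / 2)) t := by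
  have h : HasDerivAt (fun s : ℂ => (s + s⁻¹) / 2) ((1 + -(t ^ 2)⁻¹) / 2) t :=
    ((hasDerivAt_id t).add (hasDerivAt_inv ht)).div_const 2
  have h2 := (h.const_mul ((shalf g : ℂ) * I)).const_add (cmid g : ℂ)
  rw [← sub_eq_add_neg] at h2
  exact h2

/-- The derivative of `jX` does not vanish off the unit circle (`g ≥ 1`, `‖t‖ > 1`). [folklore] -/
theorem deriv_jX_ne_zero (hg : 1 ≤ g) {t : ℂ} (ht : 1 < ‖t‖) :
    (shalf g : ℂ) * I * ((1 - (t ^ 2)⁻¹) / 2) ≠ 0 := by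
  refine mul_ne_zero (mul_ne_zero (by exact_mod_cast (shalf_pos hg).ne') I_ne_zero) ?_
  refine div_ne_zero (sub_ne_zero.2 fun h => ?_) two_ne_zero
  have h1 : ‖t ^ 2‖ = 1 := by
    have := congrArg norm h; rw [norm_inv, norm_one] at this
    exact inv_eq_one.1 this.symm
  rw [norm_pow] at h1
  nlinarith

/-- `jX` is complex-differentiable off `0`. [folklore] -/
theorem differentiableAt_jX (g : ℕ) {t : ℂ} (ht : t ≠ 0) : DifferentiableAt ℂ (jX g) t :=
  (hasDerivAt_jX g ht).differentiableAt

/-- **`jY` is holomorphic at every `t ≠ 0` with `cos θ_1 < Re jX t`.** [folklore] -/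
theorem differentiableAt_jY (g : ℕ) {t : ℂ} (ht : t ≠ 0) (hs : Real.cos (branchAngle g 1) < (jX g t).re) :
    DifferentiableAt ℂ (jY g) t := by
  unfold jY
  have h1 : DifferentiableAt ℂ (fun s : ℂ => (shalf g : ℂ) * I * ((s - s⁻¹) / 2)) t := by
    refine (differentiableAt_const _).mul (((differentiableAt_id).sub ?_).div_const 2)
    exact differentiableAt_inv ht
  exact h1.mul ((differentiableAt_bS hs).comp t (differentiableAt_jX g ht))

/-- The good set `{t ≠ 0, cos θ_1 < Re jX t}` is open. [folklore] -/
theorem isOpen_goodSet (g : ℕ) :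
    IsOpen {t : ℂ | t ≠ 0 ∧ Real.cos (branchAngle g 1) < (jX g t).re} := by
  have hc : ContinuousOn (fun t => (jX g t).re) {t : ℂ | t ≠ 0} := fun t ht =>
    (Complex.continuous_re.continuousAt.comp (differentiableAt_jX g ht).continuousAt).continuousWithinAt
  exact hc.isOpen_inter_preimage isOpen_ne (isOpen_Ioi (a := Real.cos (branchAngle g 1)))

/-- **`jY` is real `C^∞` at every point of the good set.** [folklore] -/
theorem contDiffAt_jY (g : ℕ) {t : ℂ} (ht : t ≠ 0) (hs : Real.cos (branchAngle g 1) < (jX g t).re) :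
    ContDiffAt ℝ ∞ (jY g) t := by
  have hU := isOpen_goodSet g
  have hd : DifferentiableOn ℂ (jY g) {t : ℂ | t ≠ 0 ∧ Real.cos (branchAngle g 1) < (jX g t).re} :=
    fun s hs' => (differentiableAt_jY g hs'.1 hs'.2).differentiableWithinAt
  exact ((hd.contDiffOn hU).restrict_scalars ℝ).contDiffAt (hU.mem_nhds ⟨ht, hs⟩)

/-- **`jX` is real `C^∞` off `0`.** [folklore] -/
theorem contDiffAt_jX (g : ℕ) {t : ℂ} (ht : t ≠ 0) : ContDiffAt ℝ ∞ (jX g) t := by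
  have hd : DifferentiableOn ℂ (jX g) {t : ℂ | t ≠ 0} :=
    fun s hs' => (differentiableAt_jX g hs').differentiableWithinAt
  exact ((hd.contDiffOn isOpen_ne).restrict_scalars ℝ).contDiffAt (isOpen_ne.mem_nhds ht)

/-- `jX` is continuous at every `t ≠ 0`. [folklore] -/
theorem continuousAt_jX (g : ℕ) {t : ℂ} (ht : t ≠ 0) : ContinuousAt (jX g) t :=
  (differentiableAt_jX g ht).continuousAt

/-- `jY` is continuous at every point of the good set. [folklore] -/
theorem continuousAt_jY (g : ℕ) {t : ℂ} (ht : t ≠ 0) (hs : Real.cos (branchAngle g 1) < (jX g t).re) :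
    ContinuousAt (jY g) t :=
  (differentiableAt_jY g ht hs).continuousAt

end Summit.SmoothPoincare4.SmoothPoincare4.Theorems.AcyclicBisectionExists.ModpBraidOrbits

end
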